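import Mathlib.Analysis.MeanInequalities
import Mathlib.Analysis.SpecialFunctions.Pow.Real
import Mathlib.Analysis.SpecialFunctions.Pow.NNReal
import Mathlib.Analysis.SpecialFunctions.Log.Base
import Mathlib.Algebra.BigOperators.Ring.Finset
import Mathlib.Algebra.BigOperators.Group.Finset.Powerset
import Mathlib.Data.Fintype.Powerset
import HarnessLib

/-!
# `NoHeavyLowerTail` (crux stmt-CriticalPhenomena-4575), abstract sunflower cubic: preliminaries for the K-DECREASING-FUNCTIONS LEMMA —
# the finite cube with independent coordinates, min-functions, and conditioning on two coordinates

Support file (seat `prim-ineq-prove-1` gen 34; `--supports stmt-CriticalPhenomena-4575`).  Pure finite probability; no `sorry`, no named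
facts.  Memo: run/shared/lean/prim/prim-ineq-prove-1/FINDING-PRINCIPALCORE-prove1-g34.md §4.  Sequel: `…SunflowerKDecreasing` (the lemma).

* `wt p S = ∏_e (1 − p e if e ∈ S else p e)` — law of a random subset `S` of a finite type `g` whose coordinate `e` is ABSENT with
  probability `p e`; `Ex p F = Σ_S wt p S · F S`; `sum_wt` (mass one), `Ex_mono`, `Ex_le_const`, `Ex_nonneg`, degenerate coordinates.
* `fmin R r S = min(R, min_{e∈S} r e)` — the MIN-FUNCTIONS; `fmin_insert`, monotonicity `fmin_insert_le`, SUPERMODULARITY on squares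
  `fmin_supermodular`, and `le_fmin_of_antitone`: every antitone `F ≤ R` lies below the min-function of its singleton values.
* Conditioning on two coordinates `e ≠ e'`: `wrest` (weight of the other coordinates), `condSum` (the four conditional sums `A_{ab}`),
  the expansion `Ex_expand : Ex p F = xy·A₀₀ + x(1−y)·A₀₁ + (1−x)y·A₁₀ + (1−x)(1−y)·A₁₁` (`x = p e`, `y = p e'`), independence of the
  `A_{ab}` from `p e, p e'` (`condSum_update`), their monotonicity (`condSum_anti`) and supermodularity (`condSum_supermod`) for
  insertion-decreasing / square-supermodular `F`, and `sum_wrest`, `one_le_condSum`.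
-/

namespace Summit.CriticalPhenomena.PercolationContinuityZ3.Theorems.SunflowerPartition

namespace KDecreasing

open Finset Real

variable {g : Type*} [Fintype g] [DecidableEq g]

/-! ## Weights and expectation on the finite cube -/

/-- Law of the random set `S`: coordinate `e` is absent with probability `p e`, independently. [this work] -/
def wt (p : g → ℝ) (S : Finset g) : ℝ := ∏ e, if e ∈ S then 1 - p e else p e

/-- Expectation of `F(S)`. [this work] -/
def Ex (p : g → ℝ) (F : Finset g → ℝ) : ℝ := ∑ S, wt p S * F S

/-- Weights are nonnegative for `p ∈ [0,1]`. [this work] -/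
theorem wt_nonneg {p : g → ℝ} (hp : ∀ e, 0 ≤ p e ∧ p e ≤ 1) (S : Finset g) : 0 ≤ wt p S := by
  unfold wt
  refine Finset.prod_nonneg fun e _ => ?_
  split_ifs
  · linarith [(hp e).2]
  · exact (hp e).1

/-- Product form of the weight. [this work] -/
theorem wt_eq (p : g → ℝ) (S : Finset g) : wt p S = (∏ e ∈ S, (1 - p e)) * ∏ e ∈ Sᶜ, p e := by
  unfold wt
  rw [Finset.prod_ite]
  congr 1
  · congr 1; ext e; simp
  · congr 1; ext e; simp

/-- Total mass one. [this work] -/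
theorem sum_wt (p : g → ℝ) : ∑ S, wt p S = 1 := by
  have h := Fintype.prod_add (fun e => 1 - p e) (fun e => p e)
  simp only [sub_add_cancel, Finset.prod_const_one] at h
  rw [h]
  exact Finset.sum_congr rfl fun S _ => (wt_eq p S)

/-- Monotonicity of the expectation. [this work] -/
theorem Ex_mono {p : g → ℝ} (hp : ∀ e, 0 ≤ p e ∧ p e ≤ 1) {F G : Finset g → ℝ} (h : ∀ S, F S ≤ G S) :
    Ex p F ≤ Ex p G :=
  Finset.sum_le_sum fun S _ => mul_le_mul_of_nonneg_left (h S) (wt_nonneg hp S)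

/-- Expectation of a function bounded by `c` on the support is `≤ c`. [this work] -/
theorem Ex_le_const {p : g → ℝ} (hp : ∀ e, 0 ≤ p e ∧ p e ≤ 1) {F : Finset g → ℝ} {c : ℝ}
    (h : ∀ S, wt p S ≠ 0 → F S ≤ c) : Ex p F ≤ c := by
  calc Ex p F ≤ ∑ S, wt p S * c := by
        refine Finset.sum_le_sum fun S _ => ?_
        by_cases h0 : wt p S = 0
        · simp [h0]
        · exact mul_le_mul_of_nonneg_left (h S h0) (wt_nonneg hp S)
    _ = c := by rw [← Finset.sum_mul, sum_wt, one_mul]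

/-- Nonnegativity of the expectation of a nonnegative function. [this work] -/
theorem Ex_nonneg {p : g → ℝ} (hp : ∀ e, 0 ≤ p e ∧ p e ≤ 1) {F : Finset g → ℝ} (h : ∀ S, 0 ≤ F S) : 0 ≤ Ex p F :=
  Finset.sum_nonneg fun S _ => mul_nonneg (wt_nonneg hp S) (h S)

/-- If `p e = 0` then `e ∈ S` almost surely: weights of sets missing `e` vanish. [this work] -/
theorem wt_eq_zero_of_notMem {p : g → ℝ} {e : g} (he : p e = 0) {S : Finset g} (hS : e ∉ S) : wt p S = 0 := by
  unfold wt
  exact Finset.prod_eq_zero (Finset.mem_univ e) (by simp [hS, he])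

/-- If `p e = 1` then `e ∉ S` almost surely. [this work] -/
theorem wt_eq_zero_of_mem {p : g → ℝ} {e : g} (he : p e = 1) {S : Finset g} (hS : e ∈ S) : wt p S = 0 := by
  unfold wt
  exact Finset.prod_eq_zero (Finset.mem_univ e) (by simp [hS, he])

/-! ## The min-function and its two structural properties -/

/-- `fmin R r S = min(R, min_{e∈S} r e)` (`= R` for `S = ∅`). [this work] -/
def fmin (R : ℝ) (r : g → ℝ) (S : Finset g) : ℝ := if h : S.Nonempty then min R (S.inf' h r) else R

omit [Fintype g] [DecidableEq g] in
/-- `fmin` of the empty set. [this work] -/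
@[simp] theorem fmin_empty (R : ℝ) (r : g → ℝ) : fmin R r ∅ = R := by simp [fmin]

omit [Fintype g] in
/-- Recursion: `fmin (insert e T) = min (r e) (fmin T)`. [this work] -/
theorem fmin_insert (R : ℝ) (r : g → ℝ) (e : g) (T : Finset g) : fmin R r (insert e T) = min (r e) (fmin R r T) := by
  unfold fmin
  rw [dif_pos (Finset.insert_nonempty e T)]
  by_cases hT : T.Nonempty
  · rw [dif_pos hT, Finset.inf'_insert]
    change min R (min (r e) (T.inf' hT r)) = _
    rw [min_left_comm]
  · rw [Finset.not_nonempty_iff_eq_empty] at hT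
    subst hT
    simp [min_comm]

omit [Fintype g] in
/-- `fmin` of a singleton. [this work] -/
theorem fmin_singleton (R : ℝ) (r : g → ℝ) (e : g) : fmin R r {e} = min (r e) R := by
  rw [← Finset.insert_empty, fmin_insert, fmin_empty]

omit [Fintype g] [DecidableEq g] in
/-- `fmin ≤ R`. [this work] -/
theorem fmin_le_R (R : ℝ) (r : g → ℝ) (S : Finset g) : fmin R r S ≤ R := by
  unfold fmin; split_ifs <;> simp

omit [Fintype g] [DecidableEq g] in
/-- `fmin ≤ r e` for `e ∈ S`. [this work] -/
theorem fmin_le_of_mem (R : ℝ) (r : g → ℝ) {S : Finset g} {e : g} (he : e ∈ S) : fmin R r S ≤ r e := by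
  unfold fmin
  rw [dif_pos ⟨e, he⟩]
  exact le_trans (min_le_right _ _) (Finset.inf'_le r he)

omit [Fintype g] [DecidableEq g] in
/-- `1 ≤ fmin` when `1 ≤ R` and `1 ≤ r`. [this work] -/
theorem one_le_fmin {R : ℝ} (hR : 1 ≤ R) {r : g → ℝ} (hr : ∀ e, 1 ≤ r e) (S : Finset g) : 1 ≤ fmin R r S := by
  unfold fmin
  split_ifs with h
  · exact le_min hR ((Finset.le_inf'_iff h r).2 fun e _ => hr e)
  · exact hR

omit [Fintype g] in
/-- MONOTONICITY: inserting a coordinate can only decrease `fmin`. [this work] -/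
theorem fmin_insert_le (R : ℝ) (r : g → ℝ) (e : g) (T : Finset g) : fmin R r (insert e T) ≤ fmin R r T := by
  rw [fmin_insert]; exact min_le_right _ _

omit [Fintype g] in
/-- SUPERMODULARITY on a square: `fmin T + fmin (T ∪ {e,e'}) ≥ fmin (T ∪ {e}) + fmin (T ∪ {e'})`. [this work] -/
theorem fmin_supermodular (R : ℝ) (r : g → ℝ) (e e' : g) (T : Finset g) :
    fmin R r (insert e T) + fmin R r (insert e' T) ≤ fmin R r T + fmin R r (insert e (insert e' T)) := by
  rw [fmin_insert, fmin_insert, fmin_insert, fmin_insert]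
  set m := fmin R r T
  simp only [min_def]
  split_ifs <;> linarith

omit [Fintype g] [DecidableEq g] in
/-- ANTITONE FUNCTIONS ARE BELOW THEIR MIN-FUNCTION: if `F` is antitone with `F ≤ R` then `F S ≤ fmin R (fun e => F {e}) S`. [this work] -/
theorem le_fmin_of_antitone {F : Finset g → ℝ} (hF : ∀ S T, S ⊆ T → F T ≤ F S) {R : ℝ} (hR : ∀ S, F S ≤ R) (S : Finset g) :
    F S ≤ fmin R (fun e => F {e}) S := by
  unfold fmin
  split_ifs with h
  · refine le_min (hR S) ((Finset.le_inf'_iff h _).2 fun e he => hF _ _ (Finset.singleton_subset_iff.2 he))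
  · exact hR S

/-! ## Conditioning on two coordinates -/

section TwoCoords

variable (p : g → ℝ) (e e' : g)

/-- The weight of the OTHER coordinates (all but `e`, `e'`). [this work] -/
def wrest (p : g → ℝ) (e e' : g) (T : Finset g) : ℝ :=
  ∏ x ∈ (Finset.univ.erase e).erase e', if x ∈ T then 1 - p x else p x

/-- Insert `x` into `T` iff the flag is set. [this work] -/
def addIf (b : Bool) (x : g) (T : Finset g) : Finset g := if b then insert x T else T

/-- The four conditional sums `A_{ab}` (`a`: is `e` present, `b`: is `e'` present). [this work] -/
def condSum (p : g → ℝ) (e e' : g) (F : Finset g → ℝ) (se se' : Bool) : ℝ :=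
  ∑ T ∈ ((Finset.univ.erase e).erase e').powerset, wrest p e e' T * F (addIf se e (addIf se' e' T))

omit [Fintype g] in
/-- `addIf` unfolded. [this work] -/
@[simp] theorem addIf_true (x : g) (T : Finset g) : addIf true x T = insert x T := rfl

omit [Fintype g] in
/-- `addIf` unfolded. [this work] -/
@[simp] theorem addIf_false (x : g) (T : Finset g) : addIf false x T = T := rfl

/-- `wrest` does not see the coordinates `e`, `e'` of its argument. [this work] -/
theorem wrest_congr {T T' : Finset g} (h : ∀ x, x ≠ e → x ≠ e' → (x ∈ T ↔ x ∈ T')) : wrest p e e' T = wrest p e e' T' := by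
  unfold wrest
  refine Finset.prod_congr rfl fun x hx => ?_
  rw [Finset.mem_erase, Finset.mem_erase] at hx
  by_cases hxT : x ∈ T
  · rw [if_pos hxT, if_pos ((h x hx.2.1 hx.1).1 hxT)]
  · rw [if_neg hxT, if_neg (fun h' => hxT ((h x hx.2.1 hx.1).2 h'))]

/-- `wrest` does not depend on `p e`, `p e'`. [this work] -/
theorem wrest_update (x y : ℝ) (T : Finset g) :
    wrest (Function.update (Function.update p e x) e' y) e e' T = wrest p e e' T := by
  unfold wrest
  refine Finset.prod_congr rfl fun z hz => ?_
  rw [Finset.mem_erase, Finset.mem_erase] at hz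
  rw [Function.update_of_ne hz.1, Function.update_of_ne hz.2.1]

/-- Hence the conditional sums do not depend on `p e`, `p e'`. [this work] -/
theorem condSum_update (x y : ℝ) (F : Finset g → ℝ) (se se' : Bool) :
    condSum (Function.update (Function.update p e x) e' y) e e' F se se' = condSum p e e' F se se' := by
  unfold condSum
  refine Finset.sum_congr rfl fun T _ => ?_
  rw [wrest_update]

/-- The conditional weights are nonnegative. [this work] -/
theorem wrest_nonneg (hp : ∀ x, 0 ≤ p x ∧ p x ≤ 1) (T : Finset g) : 0 ≤ wrest p e e' T :=
  Finset.prod_nonneg fun x _ => by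
    split_ifs
    · linarith [(hp x).2]
    · exact (hp x).1

variable {p e e'}

/-- Splitting the weight: `wt p S = (factor e) · (factor e') · wrest`. [this work] -/
theorem wt_eq_mul_wrest (hne : e ≠ e') (S : Finset g) :
    wt p S = (if e ∈ S then 1 - p e else p e) * ((if e' ∈ S then 1 - p e' else p e') * wrest p e e' S) := by
  unfold wt wrest
  rw [← Finset.mul_prod_erase Finset.univ _ (Finset.mem_univ e),
    ← Finset.mul_prod_erase (Finset.univ.erase e) _ (Finset.mem_erase.2 ⟨Ne.symm hne, Finset.mem_univ e'⟩)]

/-- **Two-coordinate expansion** of the expectation (`x = p e`, `y = p e'`):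
`Ex p F = xy·A₀₀ + x(1−y)·A₀₁ + (1−x)y·A₁₀ + (1−x)(1−y)·A₁₁`. [this work] -/
theorem Ex_expand (hne : e ≠ e') (F : Finset g → ℝ) :
    Ex p F = p e * p e' * condSum p e e' F false false + p e * (1 - p e') * condSum p e e' F false true +
      (1 - p e) * p e' * condSum p e e' F true false + (1 - p e) * (1 - p e') * condSum p e e' F true true := by
  unfold Ex condSum
  set rest := (Finset.univ.erase e).erase e' with hrest
  have he'r : e' ∉ rest := fun h => by simp [hrest] at h
  have her' : e ∉ rest := fun h => by simp [hrest] at h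
  have her : e ∉ insert e' rest := fun h => by
    rcases Finset.mem_insert.1 h with h | h
    · exact hne h
    · exact her' h
  have huniv : (Finset.univ : Finset g) = insert e (insert e' rest) := by
    ext x
    simp only [Finset.mem_univ, Finset.mem_insert, hrest, Finset.mem_erase, true_iff]
    tauto
  have key : ∀ T ∈ rest.powerset, wt p T = p e * p e' * wrest p e e' T ∧
      wt p (insert e' T) = p e * (1 - p e') * wrest p e e' T ∧
      wt p (insert e T) = (1 - p e) * p e' * wrest p e e' T ∧
      wt p (insert e (insert e' T)) = (1 - p e) * (1 - p e') * wrest p e e' T := by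
    intro T hT
    rw [Finset.mem_powerset] at hT
    have h1 : e ∉ T := fun h => her' (hT h)
    have h2 : e' ∉ T := fun h => he'r (hT h)
    have w1 : wrest p e e' (insert e' T) = wrest p e e' T :=
      wrest_congr p e e' fun x _ hx' => by simp [Finset.mem_insert, hx']
    have w2 : wrest p e e' (insert e T) = wrest p e e' T :=
      wrest_congr p e e' fun x hx _ => by simp [Finset.mem_insert, hx]
    have w3 : wrest p e e' (insert e (insert e' T)) = wrest p e e' T :=
      wrest_congr p e e' fun x hx hx' => by simp [Finset.mem_insert, hx, hx']
    refine ⟨?_, ?_, ?_, ?_⟩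
    · rw [wt_eq_mul_wrest hne, if_neg h1, if_neg h2]; ring
    · rw [wt_eq_mul_wrest hne, if_neg (by simp [Finset.mem_insert, hne, h1]), if_pos (Finset.mem_insert_self _ _), w1]; ring
    · rw [wt_eq_mul_wrest hne, if_pos (Finset.mem_insert_self _ _), if_neg (by simp [Finset.mem_insert, Ne.symm hne, h2]), w2]
      ring
    · rw [wt_eq_mul_wrest hne, if_pos (Finset.mem_insert_self _ _),
        if_pos (Finset.mem_insert_of_mem (Finset.mem_insert_self _ _)), w3]
      ring
  rw [← Finset.powerset_univ, huniv, Finset.sum_powerset_insert her, Finset.sum_powerset_insert he'r,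
    Finset.sum_powerset_insert he'r]
  simp only [addIf_true, addIf_false, Finset.mul_sum]
  have e00 : ∑ T ∈ rest.powerset, wt p T * F T = ∑ T ∈ rest.powerset, p e * p e' * (wrest p e e' T * F T) :=
    Finset.sum_congr rfl fun T hT => by rw [(key T hT).1]; ring
  have e01 : ∑ T ∈ rest.powerset, wt p (insert e' T) * F (insert e' T) =
      ∑ T ∈ rest.powerset, p e * (1 - p e') * (wrest p e e' T * F (insert e' T)) :=
    Finset.sum_congr rfl fun T hT => by rw [(key T hT).2.1]; ring
  have e10 : ∑ T ∈ rest.powerset, wt p (insert e T) * F (insert e T) =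
      ∑ T ∈ rest.powerset, (1 - p e) * p e' * (wrest p e e' T * F (insert e T)) :=
    Finset.sum_congr rfl fun T hT => by rw [(key T hT).2.2.1]; ring
  have e11 : ∑ T ∈ rest.powerset, wt p (insert e (insert e' T)) * F (insert e (insert e' T)) =
      ∑ T ∈ rest.powerset, (1 - p e) * (1 - p e') * (wrest p e e' T * F (insert e (insert e' T))) :=
    Finset.sum_congr rfl fun T hT => by rw [(key T hT).2.2.2]; ring
  rw [e00, e01, e10, e11]
  ring

/-- Monotonicity of the conditional sums for a function that decreases under insertion:
presence of `e'` (resp. `e`) lowers the sum. [this work] -/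
theorem condSum_anti (hp : ∀ x, 0 ≤ p x ∧ p x ≤ 1) {F : Finset g → ℝ} (hF : ∀ (x : g) (T : Finset g), F (insert x T) ≤ F T)
    (se : Bool) :
    condSum p e e' F se true ≤ condSum p e e' F se false ∧ condSum p e e' F true se ≤ condSum p e e' F false se := by
  unfold condSum
  constructor
  · refine Finset.sum_le_sum fun T _ => mul_le_mul_of_nonneg_left ?_ (wrest_nonneg p e e' hp T)
    cases se
    · simpa using hF e' T
    · simp only [addIf_true, addIf_false]
      rw [Finset.insert_comm]
      exact hF e' _
  · refine Finset.sum_le_sum fun T _ => mul_le_mul_of_nonneg_left ?_ (wrest_nonneg p e e' hp T)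
    cases se
    · simpa using hF e T
    · simpa using hF e _

/-- Supermodularity of the conditional sums: `A₀₁ + A₁₀ ≤ A₀₀ + A₁₁` for a square-supermodular `F`. [this work] -/
theorem condSum_supermod (hp : ∀ x, 0 ≤ p x ∧ p x ≤ 1) {F : Finset g → ℝ}
    (hF : ∀ (x y : g) (T : Finset g), F (insert x T) + F (insert y T) ≤ F T + F (insert x (insert y T))) :
    condSum p e e' F false true + condSum p e e' F true false ≤ condSum p e e' F false false + condSum p e e' F true true := by
  unfold condSum
  rw [← Finset.sum_add_distrib, ← Finset.sum_add_distrib]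
  refine Finset.sum_le_sum fun T _ => ?_
  simp only [addIf_true, addIf_false]
  rw [← mul_add, ← mul_add]
  refine mul_le_mul_of_nonneg_left ?_ (wrest_nonneg p e e' hp T)
  linarith [hF e e' T]

end TwoCoords

/-! ## Mass of the conditional weights -/

section Mass

variable (p : g → ℝ) (e e' : g)

/-- The conditional weights have total mass one. [this work] -/
theorem sum_wrest : ∑ T ∈ ((Finset.univ.erase e).erase e').powerset, wrest p e e' T = 1 := by
  set rest := (Finset.univ.erase e).erase e'
  have h := Finset.prod_add (fun x => 1 - p x) (fun x => p x) rest
  simp only [sub_add_cancel, Finset.prod_const_one] at h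
  rw [h]
  refine Finset.sum_congr rfl fun T hT => ?_
  rw [Finset.mem_powerset] at hT
  unfold wrest
  rw [Finset.prod_ite, Finset.filter_not, Finset.filter_mem_eq_inter, Finset.inter_eq_right.2 hT]

variable {p e e'}

/-- Conditional sums of a function `≥ 1` are `≥ 1`. [this work] -/
theorem one_le_condSum (hp : ∀ x, 0 ≤ p x ∧ p x ≤ 1) {F : Finset g → ℝ} (hF : ∀ S, 1 ≤ F S) (se se' : Bool) :
    1 ≤ condSum p e e' F se se' := by
  unfold condSum
  rw [← sum_wrest p e e']
  refine Finset.sum_le_sum fun T _ => ?_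
  calc wrest p e e' T = wrest p e e' T * 1 := (mul_one _).symm
    _ ≤ wrest p e e' T * F _ := mul_le_mul_of_nonneg_left (hF _) (wrest_nonneg p e e' hp T)

end Mass

end KDecreasing

end Summit.CriticalPhenomena.PercolationContinuityZ3.Theorems.SunflowerPartition
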